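import Summits.Ventures.FusionMHD.Bench.SolovevPCFIterQedgeBridge

/-!
# F1 / QEDGE — the closed edge loop of the ITER-like PCF Solov'ev equilibrium and Freidberg's `safetyFactorE`
(venture LADDER-GRIDFUSION, rung F1.a; cell `gridfusion`, seat `gridfusion-sos-6`; generated by
`HOME/cert/sos-6/bridge/emit_bridge.py` (`BRIDGE_CASE=iter`), §6 of the bridge, split off for the 400-line rule)

`SolovevPCFIterQedgeBridge.lean` proves, arc by arc, that the Euclidean `(6.35)` line integral of `1/(R²B_p)` over the four
quarter arcs of the edge `Ψ = 0` of model-5's `SolovevPCF.IterLike.psi` sums to `edgeI/(2√K)`. This file assembles the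
four arcs into ONE closed parametrised loop `edgeLoop : [0,4] → ℝ²` and states the result for the Literature functional
`Literature.MathematicalPhysics.MHD.GradShafranov.safetyFactorE` [cite: Freidberg2014, §6.3.5 eq. (6.35)] (Euclidean
arc length, RULING 15 repair of the sup-norm `loopIntegral`): **`safetyFactorE F Ψ edgeLoop 4 = F · qEdgeOverF`**, with
`qEdgeOverF` the kernel-certified number of `SolovevPCFIterQedge.lean`. Ingredients: the loop density agrees with each arc's
density on the open parameter pieces (local agreement ⇒ equal one-sided data are not needed: `Filter.EventuallyEq.deriv_eq`),
reversal/shift invariance of the density, integrability from the continuous certified pieces, `integral_add_adjacent_intervals`.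
HONEST FRAMING: CERTIFIED (kernel) statement about the typed MODEL objects; nothing about a device. NOT here: continuity of
`edgeLoop` at the three joints as a `Continuous` statement (the joint VALUES agree: `arc_joints`), and that the loop is
injective / exhausts `{Ψ = 0, R > 0}`.
-/

open Real MeasureTheory intervalIntegral Set
open Literature.MathematicalPhysics.MHD.GradShafranov (fieldBpol)
open Literature.MathematicalPhysics.MHD.Solovev
open Summit.Ventures.FusionMHD.Models.SolovevPCF

noncomputable section

namespace Summit.Ventures.FusionMHD.Bench.SolovevPCFIter

/-! ## §6 The closed edge loop and Freidberg's `safetyFactorE` (6.35) over it -/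

/-- The closed edge loop `Ψ = 0`, `t ∈ [0, 4]`: outboard-upper arc (`w = t`), inboard-upper arc reversed (`w = 2 − t`),
inboard-lower arc (`w = t − 2`), outboard-lower arc reversed (`w = 4 − t`); consecutive pieces meet (`arc_joints`) and
`edgeLoop 0 = edgeLoop 4` (`edgeLoop_closed`). [folklore] -/
def edgeLoop (t : ℝ) : ℝ × ℝ :=
  if t ≤ 1 then arc 1 1 t
  else if t ≤ 2 then arc (-1) 1 (2 - t)
  else if t ≤ 3 then arc (-1) (-1) (t - 2)
  else arc 1 (-1) (4 - t)

/-- The loop is closed (both ends are the outboard midplane point `(1+ε, 0)`). [folklore] -/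
theorem edgeLoop_closed : edgeLoop 0 = edgeLoop 4 := by
  obtain ⟨h1, -, -⟩ := arc_joints 1
  obtain ⟨h1', -, -⟩ := arc_joints (-1)
  have e0 : edgeLoop 0 = arc 1 1 0 := by simp [edgeLoop]
  have e4 : edgeLoop 4 = arc 1 (-1) (4 - 4) := by unfold edgeLoop; norm_num
  rw [e0, e4, show (4 : ℝ) - 4 = 0 by norm_num, h1, h1']

/-- Piece 1 (`0 < t < 1`). [folklore] -/
theorem edgeLoop_eq₁ {t : ℝ} (ht : t ∈ Ioo (0 : ℝ) 1) : edgeLoop =ᶠ[nhds t] fun s => arc 1 1 s := by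
  filter_upwards [Ioo_mem_nhds ht.1 ht.2] with s hs
  simp only [edgeLoop, if_pos hs.2.le]

/-- Piece 2 (`1 < t < 2`). [folklore] -/
theorem edgeLoop_eq₂ {t : ℝ} (ht : t ∈ Ioo (1 : ℝ) 2) : edgeLoop =ᶠ[nhds t] fun s => arc (-1) 1 (2 - s) := by
  filter_upwards [Ioo_mem_nhds ht.1 ht.2] with s hs
  simp only [edgeLoop, if_neg (not_le.mpr hs.1), if_pos hs.2.le]

/-- Piece 3 (`2 < t < 3`). [folklore] -/
theorem edgeLoop_eq₃ {t : ℝ} (ht : t ∈ Ioo (2 : ℝ) 3) : edgeLoop =ᶠ[nhds t] fun s => arc (-1) (-1) (s - 2) := by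
  filter_upwards [Ioo_mem_nhds ht.1 ht.2] with s hs
  have h1 : ¬ s ≤ 1 := by intro h; linarith [hs.1]
  simp only [edgeLoop, if_neg h1, if_neg (not_le.mpr hs.1), if_pos hs.2.le]

/-- Piece 4 (`3 < t < 4`). [folklore] -/
theorem edgeLoop_eq₄ {t : ℝ} (ht : t ∈ Ioo (3 : ℝ) 4) : edgeLoop =ᶠ[nhds t] fun s => arc 1 (-1) (4 - s) := by
  filter_upwards [Ioo_mem_nhds ht.1 ht.2] with s hs
  have h1 : ¬ s ≤ 1 := by intro h; linarith [hs.1]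
  have h2 : ¬ s ≤ 2 := by intro h; linarith [hs.1]
  simp only [edgeLoop, if_neg h1, if_neg h2, if_neg (not_le.mpr hs.1)]

/-- The `(6.35)` integrand along a parametrised curve: `(1/(R²B_p))(γ(t)) · |γ′(t)|`. [folklore] -/
def loopDens (γ : ℝ → ℝ × ℝ) (t : ℝ) : ℝ := qIntegrand IterLike.psi (γ t).1 (γ t).2 * Literature.MathematicalPhysics.MHD.GradShafranov.speed γ t

/-- A curve that agrees with `γ` near `t` has the same `(6.35)` density at `t`. [folklore] -/
theorem loopDens_congr {γ γ' : ℝ → ℝ × ℝ} {t : ℝ} (h : γ =ᶠ[nhds t] γ') : loopDens γ t = loopDens γ' t := by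
  have hv : γ t = γ' t := h.eq_of_nhds
  have h1 : (fun s => (γ s).1) =ᶠ[nhds t] fun s => (γ' s).1 := h.mono fun s hs => by simp only [hs]
  have h2 : (fun s => (γ s).2) =ᶠ[nhds t] fun s => (γ' s).2 := h.mono fun s hs => by simp only [hs]
  unfold loopDens Literature.MathematicalPhysics.MHD.GradShafranov.speed
  rw [hv, h1.deriv_eq, h2.deriv_eq]

/-- Reversing / shifting the parameter does not change the density: `w = a − s`. [folklore] -/
theorem loopDens_comp_const_sub (γ : ℝ → ℝ × ℝ) (a t : ℝ) :
    loopDens (fun s => γ (a - s)) t = loopDens γ (a - t) := by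
  have h1 : deriv (fun s => (γ (a - s)).1) t = -deriv (fun w => (γ w).1) (a - t) :=
    deriv_comp_const_sub (f := fun w => (γ w).1) (a := a) (x := t)
  have h2 : deriv (fun s => (γ (a - s)).2) t = -deriv (fun w => (γ w).2) (a - t) :=
    deriv_comp_const_sub (f := fun w => (γ w).2) (a := a) (x := t)
  simp only [loopDens, Literature.MathematicalPhysics.MHD.GradShafranov.speed, h1, h2, neg_sq]

/-- Shifting the parameter: `w = s − a`. [folklore] -/
theorem loopDens_comp_sub_const (γ : ℝ → ℝ × ℝ) (a t : ℝ) :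
    loopDens (fun s => γ (s - a)) t = loopDens γ (t - a) := by
  have h1 : deriv (fun s => (γ (s - a)).1) t = deriv (fun w => (γ w).1) (t - a) :=
    deriv_comp_sub_const (f := fun w => (γ w).1) (a := a) (x := t)
  have h2 : deriv (fun s => (γ (s - a)).2) t = deriv (fun w => (γ w).2) (t - a) :=
    deriv_comp_sub_const (f := fun w => (γ w).2) (a := a) (x := t)
  simp only [loopDens, Literature.MathematicalPhysics.MHD.GradShafranov.speed, h1, h2]

/-- Each arc density is integrable on `[0, 1]` (it equals the continuous certified piece there). [folklore] -/
theorem loopDens_arc_integrable {σ τ : ℝ} (hσ : σ = 1 ∨ σ = -1) (hτ : τ = 1 ∨ τ = -1) :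
    IntervalIntegrable (loopDens (arc σ τ)) volume 0 1 := by
  refine ((continuousOn_piece hσ).intervalIntegrable_of_Icc zero_le_one).congr_uIoo ?_
  intro w hw
  rw [uIoo_of_le zero_le_one] at hw
  exact (qIntegrand_arc hσ hτ hw.1.le hw.2.le).symm

/-- **The (6.35) line integral over the closed loop is the sum of the four arc integrals.** [folklore] -/
theorem loopIntegralE_edgeLoop :
    Literature.MathematicalPhysics.MHD.GradShafranov.loopIntegralE edgeLoop 4 (qIntegrand IterLike.psi) =
      Literature.MathematicalPhysics.MHD.GradShafranov.loopIntegralE (arc 1 1) 1 (qIntegrand IterLike.psi) + Literature.MathematicalPhysics.MHD.GradShafranov.loopIntegralE (arc (-1) 1) 1 (qIntegrand IterLike.psi)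
      + Literature.MathematicalPhysics.MHD.GradShafranov.loopIntegralE (arc (-1) (-1)) 1 (qIntegrand IterLike.psi) + Literature.MathematicalPhysics.MHD.GradShafranov.loopIntegralE (arc 1 (-1)) 1 (qIntegrand IterLike.psi) := by
  have hG11 := loopDens_arc_integrable (Or.inl rfl) (Or.inl rfl)
  have hGm1 := loopDens_arc_integrable (σ := -1) (τ := 1) (Or.inr rfl) (Or.inl rfl)
  have hGmm := loopDens_arc_integrable (σ := -1) (τ := -1) (Or.inr rfl) (Or.inr rfl)
  have hG1m := loopDens_arc_integrable (σ := 1) (τ := -1) (Or.inl rfl) (Or.inr rfl)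
  -- the loop density on the four open pieces
  have p1 : EqOn (loopDens edgeLoop) (loopDens (arc 1 1)) (uIoo 0 1) := by
    intro t ht; rw [uIoo_of_le zero_le_one] at ht; exact loopDens_congr (edgeLoop_eq₁ ht)
  have p2 : EqOn (loopDens edgeLoop) (fun t => loopDens (arc (-1) 1) (2 - t)) (uIoo 1 2) := by
    intro t ht; rw [uIoo_of_le one_le_two] at ht
    rw [loopDens_congr (edgeLoop_eq₂ ht)]; exact loopDens_comp_const_sub (arc (-1) 1) 2 t
  have p3 : EqOn (loopDens edgeLoop) (fun t => loopDens (arc (-1) (-1)) (t - 2)) (uIoo 2 3) := by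
    intro t ht; rw [uIoo_of_le (by norm_num : (2:ℝ) ≤ 3)] at ht
    rw [loopDens_congr (edgeLoop_eq₃ ht)]; exact loopDens_comp_sub_const (arc (-1) (-1)) 2 t
  have p4 : EqOn (loopDens edgeLoop) (fun t => loopDens (arc 1 (-1)) (4 - t)) (uIoo 3 4) := by
    intro t ht; rw [uIoo_of_le (by norm_num : (3:ℝ) ≤ 4)] at ht
    rw [loopDens_congr (edgeLoop_eq₄ ht)]; exact loopDens_comp_const_sub (arc 1 (-1)) 4 t
  -- integrability of the loop density on the four pieces
  have h01 : IntervalIntegrable (loopDens edgeLoop) volume 0 1 := hG11.congr_uIoo p1.symm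
  have h12 : IntervalIntegrable (loopDens edgeLoop) volume 1 2 := by
    have h := (hGm1.comp_sub_left 2).symm
    norm_num at h
    exact h.congr_uIoo p2.symm
  have h23 : IntervalIntegrable (loopDens edgeLoop) volume 2 3 := by
    have h := hGmm.comp_sub_right 2
    norm_num at h
    exact h.congr_uIoo p3.symm
  have h34 : IntervalIntegrable (loopDens edgeLoop) volume 3 4 := by
    have h := (hG1m.comp_sub_left 4).symm
    norm_num at h
    exact h.congr_uIoo p4.symm
  -- split [0,4] and identify the pieces
  have e1 : ∫ t in (0:ℝ)..1, loopDens edgeLoop t = ∫ t in (0:ℝ)..1, loopDens (arc 1 1) t :=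
    integral_congr_uIoo p1
  have e2 : ∫ t in (1:ℝ)..2, loopDens edgeLoop t = ∫ t in (0:ℝ)..1, loopDens (arc (-1) 1) t := by
    rw [integral_congr_uIoo p2, intervalIntegral.integral_comp_sub_left (fun w => loopDens (arc (-1) 1) w) 2]
    norm_num
  have e3 : ∫ t in (2:ℝ)..3, loopDens edgeLoop t = ∫ t in (0:ℝ)..1, loopDens (arc (-1) (-1)) t := by
    rw [integral_congr_uIoo p3, intervalIntegral.integral_comp_sub_right (fun w => loopDens (arc (-1) (-1)) w) 2]
    norm_num
  have e4 : ∫ t in (3:ℝ)..4, loopDens edgeLoop t = ∫ t in (0:ℝ)..1, loopDens (arc 1 (-1)) t := by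
    rw [integral_congr_uIoo p4, intervalIntegral.integral_comp_sub_left (fun w => loopDens (arc 1 (-1)) w) 4]
    norm_num
  have split : ∫ t in (0:ℝ)..4, loopDens edgeLoop t =
      (∫ t in (0:ℝ)..1, loopDens edgeLoop t) + (∫ t in (1:ℝ)..2, loopDens edgeLoop t)
      + ((∫ t in (2:ℝ)..3, loopDens edgeLoop t) + (∫ t in (3:ℝ)..4, loopDens edgeLoop t)) := by
    rw [intervalIntegral.integral_add_adjacent_intervals h01 h12,
      intervalIntegral.integral_add_adjacent_intervals h23 h34,
      intervalIntegral.integral_add_adjacent_intervals (h01.trans h12) (h23.trans h34)]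
  show (∫ t in (0:ℝ)..4, loopDens edgeLoop t) =
    (∫ t in (0:ℝ)..1, loopDens (arc 1 1) t) + (∫ t in (0:ℝ)..1, loopDens (arc (-1) 1) t)
      + (∫ t in (0:ℝ)..1, loopDens (arc (-1) (-1)) t) + (∫ t in (0:ℝ)..1, loopDens (arc 1 (-1)) t)
  rw [split, e1, e2, e3, e4]
  ring

/-- **Freidberg's safety factor (6.35), Euclidean arc length, on the typed equilibrium's closed edge loop, is `F · qEdgeOverF`.**
Hence the Kruskal–Shafranov theorems and `qAxis_lt_qEdge` of the Qedge file are statements about the Literature functional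
`safetyFactorE` on model-5's typed equilibrium: CERTIFIED end to end. [cite: Freidberg2014, §6.3.5 eq. (6.35)] -/
theorem safetyFactorE_edgeLoop (F : ℝ) : Literature.MathematicalPhysics.MHD.GradShafranov.safetyFactorE F IterLike.psi edgeLoop 4 = F * qEdgeOverF := by
  have h4 := loopIntegralE_edgeLoop
  have hsum := lineIntegral_edge_eq
  simp only [show ∀ (γ : ℝ → ℝ × ℝ) (g : ℝ → ℝ → ℝ), lineIntegralE γ 0 1 g = Literature.MathematicalPhysics.MHD.GradShafranov.loopIntegralE γ 1 g from fun γ g => rfl] at hsum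
  unfold Literature.MathematicalPhysics.MHD.GradShafranov.safetyFactorE
  rw [show (fun R Z => 1 / (R ^ 2 * fieldBpol IterLike.psi R Z)) = qIntegrand IterLike.psi from rfl, h4]
  unfold qEdgeOverF
  have hK : (0 : ℝ) < Real.sqrt (Kconst : ℝ) := Real.sqrt_pos.2 (by unfold Kconst; push_cast; norm_num)
  have hπ := Real.pi_pos
  have hs : Literature.MathematicalPhysics.MHD.GradShafranov.loopIntegralE (arc 1 1) 1 (qIntegrand IterLike.psi) + Literature.MathematicalPhysics.MHD.GradShafranov.loopIntegralE (arc (-1) 1) 1 (qIntegrand IterLike.psi)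
      + Literature.MathematicalPhysics.MHD.GradShafranov.loopIntegralE (arc (-1) (-1)) 1 (qIntegrand IterLike.psi) + Literature.MathematicalPhysics.MHD.GradShafranov.loopIntegralE (arc 1 (-1)) 1 (qIntegrand IterLike.psi)
      = edgeI / (2 * Real.sqrt (Kconst : ℝ)) := by
    rw [← hsum]; ring
  rw [hs]
  field_simp
  ring

end Summit.Ventures.FusionMHD.Bench.SolovevPCFIter

end
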